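import Mathlib
import HarnessLib
import Summits.HubbardSuperconductivity.HubbardSuperconductivity.Theorems.KLProgrammeC4aPPKernelTrueProductForm
import Summits.HubbardSuperconductivity.HubbardSuperconductivity.Theorems.KLProgrammeC4aPPKernelTrueSignedDeriv2

/-!
# Route `KLProgramme` — crux C4a, S3 brick (B4) «(B4)-UMK1», «(U1)-M-LAW» kernel side: the product-form pp kernel `P(e,u)` is `C²` in the partner level —
# `ppTrueKernelDuu`, termwise differentiation, `contDiff_two_ppTrueKernel_u`, and the second-derivative envelopes `|∂ᵤ²P| ≤ C·(max e |u|)⁻³` THROUGH `u = −e`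

Cell `gate-hubbard-kl`, seat hubbard-kl-k3c3-p1 (g17; row «δμ-flow with klAngularMean constant piece»).  Kernel rows for k3c3-p3's «(U1)-M-LAW» (pen (R384)(A)(a);
5b-M `…C4aPreCausticLevelLineMiddle`: `hK : ContDiff ℝ 2 (K e)`, `hK1`, `hK2`).  The comparable-levels piece `M = P·(1 − κ(r) − κ(1−r))` of the smooth-floor partition
(`…C4aPPKernelSmoothPartition`) is alive AT the anti-diagonal `u = −e`, where the ratio form `N/(e+u)` is only removably smooth; the PRODUCT FORM
`P = (2/β)Σ W(ωₙ,e)W(ωₙ,u)(eu+ωₙ²)/((ωₙ²+e²)(ωₙ²+u²))` (`…C4aPPKernelTrueProductForm`, `C¹` there) has no denominator `e+u` and is differentiated termwise twice here.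
* §1 the core `c(u) = (eu+ω²)/((ω²+e²)(ω²+u²))`: `hasDerivAt_pairCore`, `hasDerivAt_pairCoreD1`, `abs_pairCore_le` (`2/ω²`), `abs_pairCoreD1_le` (`3/(2ω³)`),
  `abs_pairCoreD2_le` (`15/(2ω⁴)`), `ppTrueKernelDu_summand_eq` (the raw summand of `∂ᵤP` is `W_e(W′c + Wc′)`);
* §2 def **`ppTrueKernelDuu`**, `abs_ppTrueKernelDuu_summand_le` (uniform dominator), **`hasDerivAt_ppTrueKernelDu_u`**, `continuous_ppTrueKernelDuu_comp` (joint continuity,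
  composable form), `continuous_ppTrueKernelDuu_u`, **`contDiff_two_ppTrueKernel_u`** (`hK`), `deriv_ppTrueKernel_u`, `iteratedDeriv_two_ppTrueKernel_u`;
* §3 `ppTrueKernelDuu_eq_of_ne` (`e+u ≠ 0 ⟹ ∂ᵤ²P = ∂ᵤ²N/(e+u) − 2∂ᵤN/(e+u)² + 2N/(e+u)³`);
* §4 envelopes for EVERY `u` (the point `u = −e` by continuity): **`abs_ppTrueKernelDuu_le_inv_max_cube`** (support `c·e ≤ |u|`:
  `≤ (256B₃+768B₂+2496B₁+1528+(32B₂+48B₁+66)/c²+(48B₁+36)/c)·(max e |u|)⁻¹³`), and the near-shell all-`u` forms **`abs_ppTrueKernelDu_le_inv_max_sq_of_le_mul`**,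
  **`abs_ppTrueKernelDuu_le_inv_max_cube_of_le_mul`** (`0 < e ≤ K·Λ`).
Pure real analysis; nothing asserts (C), K3, the window or superconductivity.
References: BGM 2006 §2.4 (2.36) [cite: BenfattoGiulianiMastropietro2006]; Salmhofer 1999 §4.2.5 [cite: Salmhofer1999].
-/

noncomputable section

namespace Summit.HubbardSuperconductivity.HubbardSuperconductivity.Theorems.C4a

set_option linter.dupNamespace false -- summit = problem name (single-conjunct summit), D-0017

open Real Filter Set
open scoped Topology
open Literature.MathematicalPhysics.QuantumLattice Literature.Analysis.SpecialFunctions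

/-! ## §1 The core `c(u) = (eu+ω²)/((ω²+e²)(ω²+u²))` and its two derivatives -/

/-- `c′(u) = (e(ω²−u²) − 2uω²)/((ω²+e²)(ω²+u²)²)`. [folklore] -/
theorem hasDerivAt_pairCore {ω : ℝ} (hω : ω ≠ 0) (e u : ℝ) :
    HasDerivAt (fun v : ℝ => (e * v + ω ^ 2) / ((ω ^ 2 + e ^ 2) * (ω ^ 2 + v ^ 2)))
      ((e * (ω ^ 2 - u ^ 2) - 2 * u * ω ^ 2) / ((ω ^ 2 + e ^ 2) * (ω ^ 2 + u ^ 2) ^ 2)) u := by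
  have h1 : ω ^ 2 + e ^ 2 ≠ 0 := by positivity
  have h2 : ω ^ 2 + u ^ 2 ≠ 0 := by positivity
  have hN : HasDerivAt (fun v : ℝ => e * v + ω ^ 2) e u := by simpa using ((hasDerivAt_id u).const_mul e).add_const (ω ^ 2)
  have hD : HasDerivAt (fun v : ℝ => (ω ^ 2 + e ^ 2) * (ω ^ 2 + v ^ 2)) ((ω ^ 2 + e ^ 2) * (2 * u)) u := by
    have h0 := ((hasDerivAt_pow 2 u).const_add (ω ^ 2)).const_mul (ω ^ 2 + e ^ 2)
    refine h0.congr_deriv ?_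
    simp
  have h := hN.div hD (mul_ne_zero h1 h2)
  refine h.congr_deriv ?_
  field_simp
  ring

/-- `c″(u) = (2u(u²−3ω²)e + (6u²−2ω²)ω²)/((ω²+e²)(ω²+u²)³)`. [folklore] -/
theorem hasDerivAt_pairCoreD1 {ω : ℝ} (hω : ω ≠ 0) (e u : ℝ) :
    HasDerivAt (fun v : ℝ => (e * (ω ^ 2 - v ^ 2) - 2 * v * ω ^ 2) / ((ω ^ 2 + e ^ 2) * (ω ^ 2 + v ^ 2) ^ 2))
      ((2 * u * (u ^ 2 - 3 * ω ^ 2) * e + (6 * u ^ 2 - 2 * ω ^ 2) * ω ^ 2) / ((ω ^ 2 + e ^ 2) * (ω ^ 2 + u ^ 2) ^ 3)) u := by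
  have h1 : ω ^ 2 + e ^ 2 ≠ 0 := by positivity
  have h2 : ω ^ 2 + u ^ 2 ≠ 0 := by positivity
  have hN : HasDerivAt (fun v : ℝ => e * (ω ^ 2 - v ^ 2) - 2 * v * ω ^ 2) (e * (-(2 * u)) - 2 * ω ^ 2) u := by
    have ha : HasDerivAt (fun v : ℝ => ω ^ 2 - v ^ 2) (-(2 * u)) u := by
      have h0 := (hasDerivAt_pow 2 u).const_sub (ω ^ 2)
      refine h0.congr_deriv ?_
      simp
    have hb : HasDerivAt (fun v : ℝ => 2 * v * ω ^ 2) (2 * ω ^ 2) u := by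
      have h0 := ((hasDerivAt_id u).const_mul 2).mul_const (ω ^ 2)
      refine h0.congr_deriv ?_
      simp
    exact (ha.const_mul e).sub hb
  have hD : HasDerivAt (fun v : ℝ => (ω ^ 2 + e ^ 2) * (ω ^ 2 + v ^ 2) ^ 2) ((ω ^ 2 + e ^ 2) * (2 * (ω ^ 2 + u ^ 2) * (2 * u))) u := by
    have h0 := (((hasDerivAt_pow 2 u).const_add (ω ^ 2)).pow 2).const_mul (ω ^ 2 + e ^ 2)
    refine h0.congr_deriv ?_
    simp
  have h := hN.div hD (mul_ne_zero h1 (pow_ne_zero 2 h2))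
  refine h.congr_deriv ?_
  field_simp
  ring

/-- `|c(u)| ≤ 2/ω²`. [folklore] -/
theorem abs_pairCore_le {ω : ℝ} (hω : 0 < ω) (e u : ℝ) : |(e * u + ω ^ 2) / ((ω ^ 2 + e ^ 2) * (ω ^ 2 + u ^ 2))| ≤ 2 / ω ^ 2 := by
  refine (abs_pairSummand_core_le hω.ne' e u).trans ?_
  have ha : 1 / (ω ^ 2 + u ^ 2) ≤ 1 / ω ^ 2 := one_div_le_one_div_of_le (by positivity) (by nlinarith [sq_nonneg u])
  have hb : 1 / (ω ^ 2 + e ^ 2) ≤ 1 / ω ^ 2 := one_div_le_one_div_of_le (by positivity) (by nlinarith [sq_nonneg e])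
  calc _ ≤ 1 / ω ^ 2 + 1 / ω ^ 2 := add_le_add ha hb
    _ = 2 / ω ^ 2 := by ring

/-- `|c′(u)| ≤ 3/(2ω³)` (`|e(ω²−u²) − 2uω²| ≤ (|e|+ω)(ω²+u²)`, `|e|/(ω²+e²) ≤ 1/(2ω)`, `ω/(ω²+e²) ≤ 1/ω`). [folklore] -/
theorem abs_pairCoreD1_le {ω : ℝ} (hω : 0 < ω) (e u : ℝ) : |(e * (ω ^ 2 - u ^ 2) - 2 * u * ω ^ 2) / ((ω ^ 2 + e ^ 2) * (ω ^ 2 + u ^ 2) ^ 2)| ≤ 3 / (2 * ω ^ 3) := by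
  have h1 : 0 < ω ^ 2 + e ^ 2 := by positivity
  have h2 : 0 < ω ^ 2 + u ^ 2 := by positivity
  have hnum : |e * (ω ^ 2 - u ^ 2) - 2 * u * ω ^ 2| ≤ (|e| + ω) * (ω ^ 2 + u ^ 2) := by
    have ha : |e * (ω ^ 2 - u ^ 2)| ≤ |e| * (ω ^ 2 + u ^ 2) := by
      rw [abs_mul]; refine mul_le_mul_of_nonneg_left ?_ (abs_nonneg e)
      rw [abs_le]; constructor <;> nlinarith [sq_nonneg u, sq_nonneg ω]
    have hb : |2 * u * ω ^ 2| ≤ ω * (ω ^ 2 + u ^ 2) := by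
      rw [abs_le]; constructor <;> nlinarith [mul_nonneg hω.le (sq_nonneg (u + ω)), mul_nonneg hω.le (sq_nonneg (u - ω))]
    exact (abs_sub _ _).trans (by linarith)
  have hratio : (|e| + ω) / (ω ^ 2 + e ^ 2) ≤ 3 / (2 * ω) := by
    rw [div_le_div_iff₀ h1 (by positivity)]
    nlinarith [sq_nonneg (|e| - ω), sq_abs e, abs_nonneg e]
  rw [abs_div, abs_of_pos (mul_pos h1 (pow_pos h2 2)), div_le_div_iff₀ (mul_pos h1 (pow_pos h2 2)) (by positivity)]
  have hω2 : ω ^ 2 ≤ ω ^ 2 + u ^ 2 := by nlinarith [sq_nonneg u]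
  rw [div_le_div_iff₀ h1 (by positivity)] at hratio
  calc |e * (ω ^ 2 - u ^ 2) - 2 * u * ω ^ 2| * (2 * ω ^ 3) ≤ (|e| + ω) * (ω ^ 2 + u ^ 2) * (2 * ω ^ 3) := by gcongr
    _ = ((|e| + ω) * (2 * ω)) * ω ^ 2 * (ω ^ 2 + u ^ 2) := by ring
    _ ≤ (3 * (ω ^ 2 + e ^ 2)) * (ω ^ 2 + u ^ 2) * (ω ^ 2 + u ^ 2) := by gcongr
    _ = 3 * ((ω ^ 2 + e ^ 2) * (ω ^ 2 + u ^ 2) ^ 2) := by ring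

/-- `|c″(u)| ≤ 15/(2ω⁴)` (`|2u(u²−3ω²)e + (6u²−2ω²)ω²| ≤ 6(ω²+u²)(|e||u| + ω²)`). [folklore] -/
theorem abs_pairCoreD2_le {ω : ℝ} (hω : 0 < ω) (e u : ℝ) :
    |(2 * u * (u ^ 2 - 3 * ω ^ 2) * e + (6 * u ^ 2 - 2 * ω ^ 2) * ω ^ 2) / ((ω ^ 2 + e ^ 2) * (ω ^ 2 + u ^ 2) ^ 3)| ≤ 15 / (2 * ω ^ 4) := by
  have h1 : 0 < ω ^ 2 + e ^ 2 := by positivity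
  have h2 : 0 < ω ^ 2 + u ^ 2 := by positivity
  -- `|e||u| ≤ (ω²+e²)(ω²+u²)/(4ω²)·…`: we use `|e| ≤ (ω²+e²)/(2ω)` and `|u| ≤ (ω²+u²)/(2ω)`
  have he' : |e| * (2 * ω) ≤ ω ^ 2 + e ^ 2 := by nlinarith [sq_nonneg (|e| - ω), sq_abs e, abs_nonneg e]
  have hu' : |u| * (2 * ω) ≤ ω ^ 2 + u ^ 2 := by nlinarith [sq_nonneg (|u| - ω), sq_abs u, abs_nonneg u]
  have hA : |2 * u * (u ^ 2 - 3 * ω ^ 2) * e| ≤ 6 * (ω ^ 2 + u ^ 2) * (|u| * |e|) := by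
    rw [abs_mul, abs_mul, abs_mul, abs_of_pos (by norm_num : (0 : ℝ) < 2)]
    have : |u ^ 2 - 3 * ω ^ 2| ≤ 3 * (ω ^ 2 + u ^ 2) := by rw [abs_le]; constructor <;> nlinarith [sq_nonneg u, sq_nonneg ω]
    calc 2 * |u| * |u ^ 2 - 3 * ω ^ 2| * |e| ≤ 2 * |u| * (3 * (ω ^ 2 + u ^ 2)) * |e| := by gcongr
      _ = 6 * (ω ^ 2 + u ^ 2) * (|u| * |e|) := by ring
  have hB : |(6 * u ^ 2 - 2 * ω ^ 2) * ω ^ 2| ≤ 6 * (ω ^ 2 + u ^ 2) * ω ^ 2 := by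
    rw [abs_mul, abs_of_pos (pow_pos hω 2)]
    refine mul_le_mul_of_nonneg_right ?_ (by positivity)
    rw [abs_le]; constructor <;> nlinarith [sq_nonneg u, sq_nonneg ω]
  have hnum : |2 * u * (u ^ 2 - 3 * ω ^ 2) * e + (6 * u ^ 2 - 2 * ω ^ 2) * ω ^ 2| ≤ 6 * (ω ^ 2 + u ^ 2) * (|u| * |e| + ω ^ 2) :=
    (abs_add_le _ _).trans (by nlinarith [hA, hB])
  rw [abs_div, abs_of_pos (mul_pos h1 (pow_pos h2 3)), div_le_div_iff₀ (mul_pos h1 (pow_pos h2 3)) (by positivity)]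
  -- `6(ω²+u²)(|u||e| + ω²)·2ω⁴ ≤ 15(ω²+e²)(ω²+u²)³`
  have hue : |u| * |e| * (4 * ω ^ 2) ≤ (ω ^ 2 + u ^ 2) * (ω ^ 2 + e ^ 2) := by
    have := mul_le_mul hu' he' (by positivity) (by positivity)
    nlinarith [this]
  have hω2e : ω ^ 2 ≤ ω ^ 2 + e ^ 2 := by nlinarith [sq_nonneg e]
  have hω2u : ω ^ 2 ≤ ω ^ 2 + u ^ 2 := by nlinarith [sq_nonneg u]
  calc |2 * u * (u ^ 2 - 3 * ω ^ 2) * e + (6 * u ^ 2 - 2 * ω ^ 2) * ω ^ 2| * (2 * ω ^ 4)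
      ≤ 6 * (ω ^ 2 + u ^ 2) * (|u| * |e| + ω ^ 2) * (2 * ω ^ 4) := by gcongr
    _ = 3 * (ω ^ 2 + u ^ 2) * ω ^ 2 * (|u| * |e| * (4 * ω ^ 2)) + 12 * (ω ^ 2 + u ^ 2) * ω ^ 2 * ω ^ 2 * ω ^ 2 := by ring
    _ ≤ 3 * (ω ^ 2 + u ^ 2) * ω ^ 2 * ((ω ^ 2 + u ^ 2) * (ω ^ 2 + e ^ 2)) + 12 * (ω ^ 2 + u ^ 2) * (ω ^ 2 + u ^ 2) * (ω ^ 2 + u ^ 2) * (ω ^ 2 + e ^ 2) := by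
        gcongr
    _ ≤ 3 * (ω ^ 2 + u ^ 2) * (ω ^ 2 + u ^ 2) * ((ω ^ 2 + u ^ 2) * (ω ^ 2 + e ^ 2)) + 12 * (ω ^ 2 + u ^ 2) * (ω ^ 2 + u ^ 2) * (ω ^ 2 + u ^ 2) * (ω ^ 2 + e ^ 2) := by
        gcongr
    _ = 15 * ((ω ^ 2 + e ^ 2) * (ω ^ 2 + u ^ 2) ^ 3) := by ring

/-- The raw summand of `∂ᵤP` (as in `ppTrueKernelDu`) is `W_e·(W′(u)c(u) + W(u)c′(u))`. [folklore] -/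
theorem ppTrueKernelDu_summand_eq {ω : ℝ} (hω : ω ≠ 0) (Λ e u : ℝ) :
    uvWeightFn Λ ω e * ((uvWeightFnD1 Λ ω u * (e * u + ω ^ 2) + uvWeightFn Λ ω u * e) / ((ω ^ 2 + e ^ 2) * (ω ^ 2 + u ^ 2)) -
        uvWeightFn Λ ω u * (e * u + ω ^ 2) * (2 * u) / ((ω ^ 2 + e ^ 2) * (ω ^ 2 + u ^ 2) ^ 2)) =
      uvWeightFn Λ ω e * (uvWeightFnD1 Λ ω u * ((e * u + ω ^ 2) / ((ω ^ 2 + e ^ 2) * (ω ^ 2 + u ^ 2))) +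
        uvWeightFn Λ ω u * ((e * (ω ^ 2 - u ^ 2) - 2 * u * ω ^ 2) / ((ω ^ 2 + e ^ 2) * (ω ^ 2 + u ^ 2) ^ 2))) := by
  have h1 : ω ^ 2 + e ^ 2 ≠ 0 := by positivity
  have h2 : ω ^ 2 + u ^ 2 ≠ 0 := by positivity
  field_simp
  ring

/-! ## §2 The second derivative series of the product form -/

/-- `∂ᵤ²P = (2/β)Σ W(ωₙ,e)[W″(ωₙ,u)c(u) + 2W′(ωₙ,u)c′(u) + W(ωₙ,u)c″(u)]`. -/
def ppTrueKernelDuu (β Λ e u : ℝ) : ℝ :=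
  2 / β * ∑' n : ℕ, uvWeightFn Λ (ppFreq β n) e *
    (uvWeightFnD2 Λ (ppFreq β n) u * ((e * u + ppFreq β n ^ 2) / ((ppFreq β n ^ 2 + e ^ 2) * (ppFreq β n ^ 2 + u ^ 2))) +
      2 * uvWeightFnD1 Λ (ppFreq β n) u * ((e * (ppFreq β n ^ 2 - u ^ 2) - 2 * u * ppFreq β n ^ 2) / ((ppFreq β n ^ 2 + e ^ 2) * (ppFreq β n ^ 2 + u ^ 2) ^ 2)) +
      uvWeightFn Λ (ppFreq β n) u *
        ((2 * u * (u ^ 2 - 3 * ppFreq β n ^ 2) * e + (6 * u ^ 2 - 2 * ppFreq β n ^ 2) * ppFreq β n ^ 2) / ((ppFreq β n ^ 2 + e ^ 2) * (ppFreq β n ^ 2 + u ^ 2) ^ 3)))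

/-- **Uniform dominator of `∂ᵤ²P`'s summand**: `≤ ((16B₂+8B₁)/Λ² + 12B₁(β/π)/Λ + (15/2)(β/π)²)/ωₙ²`, uniformly in both levels. [folklore] -/
theorem abs_ppTrueKernelDuu_summand_le {β Λ : ℝ} (hβ : 0 < β) (hΛ : 0 < Λ) {B₁ B₂ : ℝ} (hB₁ : ∀ x, |deriv salmhoferCutoff x| ≤ B₁)
    (hB₂ : ∀ x, |deriv (deriv salmhoferCutoff) x| ≤ B₂) (e u : ℝ) (n : ℕ) :
    |uvWeightFn Λ (ppFreq β n) e *
      (uvWeightFnD2 Λ (ppFreq β n) u * ((e * u + ppFreq β n ^ 2) / ((ppFreq β n ^ 2 + e ^ 2) * (ppFreq β n ^ 2 + u ^ 2))) +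
        2 * uvWeightFnD1 Λ (ppFreq β n) u * ((e * (ppFreq β n ^ 2 - u ^ 2) - 2 * u * ppFreq β n ^ 2) / ((ppFreq β n ^ 2 + e ^ 2) * (ppFreq β n ^ 2 + u ^ 2) ^ 2)) +
        uvWeightFn Λ (ppFreq β n) u *
          ((2 * u * (u ^ 2 - 3 * ppFreq β n ^ 2) * e + (6 * u ^ 2 - 2 * ppFreq β n ^ 2) * ppFreq β n ^ 2) / ((ppFreq β n ^ 2 + e ^ 2) * (ppFreq β n ^ 2 + u ^ 2) ^ 3)))| ≤
      ((16 * B₂ + 8 * B₁) / Λ ^ 2 + 12 * B₁ * (β / π) / Λ + 15 / 2 * (β / π) ^ 2) * (1 / (ppFreq β n ^ 2 + 0 ^ 2)) := by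
  have hB0 := salmhoferB₁_nonneg hB₁
  have hB20 : 0 ≤ B₂ := (abs_nonneg _).trans (hB₂ 0)
  set ω := ppFreq β n with hωdef
  have hω : 0 < ω := ppFreq_pos hβ n
  have hq : 1 / ω ≤ β / π := inv_ppFreq_le hβ n
  have hS2 : 2 * Λ ^ 2 / (ω ^ 2 + Λ ^ 2) ≤ 2 := shellFactor_le_two hΛ ω
  have hWe : |uvWeightFn Λ ω e| ≤ 1 := abs_uvWeightFn_le_one _ _ _
  have hWu : |uvWeightFn Λ ω u| ≤ 1 := abs_uvWeightFn_le_one _ _ _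
  have hD1 : |uvWeightFnD1 Λ ω u| ≤ 4 * B₁ / Λ := by
    refine (abs_uvWeightFnD1_le_shell hB₁ hΛ ω u).trans ?_
    calc 2 * B₁ / Λ * (2 * Λ ^ 2 / (ω ^ 2 + Λ ^ 2)) ≤ 2 * B₁ / Λ * 2 := mul_le_mul_of_nonneg_left hS2 (by positivity)
      _ = 4 * B₁ / Λ := by ring
  have hD2 : |uvWeightFnD2 Λ ω u| ≤ (8 * B₂ + 4 * B₁) / Λ ^ 2 := by
    refine (abs_uvWeightFnD2_le_shell hB₁ hB₂ hΛ ω u).trans ?_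
    calc (4 * B₂ + 2 * B₁) / Λ ^ 2 * (2 * Λ ^ 2 / (ω ^ 2 + Λ ^ 2)) ≤ (4 * B₂ + 2 * B₁) / Λ ^ 2 * 2 := mul_le_mul_of_nonneg_left hS2 (by positivity)
      _ = (8 * B₂ + 4 * B₁) / Λ ^ 2 := by ring
  have hc0 := abs_pairCore_le hω e u
  have hc1 := abs_pairCoreD1_le hω e u
  have hc2 := abs_pairCoreD2_le hω e u
  have hp1 : |uvWeightFnD2 Λ ω u * ((e * u + ω ^ 2) / ((ω ^ 2 + e ^ 2) * (ω ^ 2 + u ^ 2)))| ≤ (8 * B₂ + 4 * B₁) / Λ ^ 2 * (2 / ω ^ 2) := by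
    rw [abs_mul]; exact mul_le_mul hD2 hc0 (abs_nonneg _) (by positivity)
  have hp2 : |2 * uvWeightFnD1 Λ ω u * ((e * (ω ^ 2 - u ^ 2) - 2 * u * ω ^ 2) / ((ω ^ 2 + e ^ 2) * (ω ^ 2 + u ^ 2) ^ 2))| ≤ 2 * (4 * B₁ / Λ) * (3 / (2 * ω ^ 3)) := by
    rw [abs_mul, abs_mul, abs_of_pos (by norm_num : (0 : ℝ) < 2)]
    exact mul_le_mul (mul_le_mul_of_nonneg_left hD1 (by norm_num)) hc1 (abs_nonneg _) (by positivity)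
  have hp3 : |uvWeightFn Λ ω u * ((2 * u * (u ^ 2 - 3 * ω ^ 2) * e + (6 * u ^ 2 - 2 * ω ^ 2) * ω ^ 2) / ((ω ^ 2 + e ^ 2) * (ω ^ 2 + u ^ 2) ^ 3))| ≤
      1 * (15 / (2 * ω ^ 4)) := by
    rw [abs_mul]; exact mul_le_mul hWu hc2 (abs_nonneg _) zero_le_one
  rw [abs_mul]
  have hsum := (abs_add_le _ _).trans (add_le_add ((abs_add_le _ _).trans (add_le_add hp1 hp2)) hp3)
  refine (mul_le_mul hWe hsum (abs_nonneg _) zero_le_one).trans ?_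
  rw [one_mul, zero_pow two_ne_zero, add_zero]
  -- convert `1/ω³ ≤ (β/π)/ω²`, `1/ω⁴ ≤ (β/π)²/ω²`
  have hω2 : 0 < ω ^ 2 := pow_pos hω 2
  have e1 : (8 * B₂ + 4 * B₁) / Λ ^ 2 * (2 / ω ^ 2) = (16 * B₂ + 8 * B₁) / Λ ^ 2 * (1 / ω ^ 2) := by ring
  have e2 : 2 * (4 * B₁ / Λ) * (3 / (2 * ω ^ 3)) = 12 * B₁ / Λ * (1 / ω) * (1 / ω ^ 2) := by field_simp; ring
  have e3 : 1 * (15 / (2 * ω ^ 4)) = 15 / 2 * (1 / ω) ^ 2 * (1 / ω ^ 2) := by field_simp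
  rw [e1, e2, e3]
  have i2 : 12 * B₁ / Λ * (1 / ω) * (1 / ω ^ 2) ≤ 12 * B₁ * (β / π) / Λ * (1 / ω ^ 2) := by
    have := mul_le_mul_of_nonneg_left hq (by positivity : (0 : ℝ) ≤ 12 * B₁ / Λ)
    calc 12 * B₁ / Λ * (1 / ω) * (1 / ω ^ 2) ≤ 12 * B₁ / Λ * (β / π) * (1 / ω ^ 2) := mul_le_mul_of_nonneg_right this (by positivity)
      _ = _ := by ring
  have i3 : 15 / 2 * (1 / ω) ^ 2 * (1 / ω ^ 2) ≤ 15 / 2 * (β / π) ^ 2 * (1 / ω ^ 2) :=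
    mul_le_mul_of_nonneg_right (mul_le_mul_of_nonneg_left (pow_le_pow_left₀ (by positivity) hq 2) (by norm_num)) (by positivity)
  nlinarith [i2, i3]

/-- **`∂ᵤ(∂ᵤP) = ppTrueKernelDuu`** everywhere (termwise differentiation of the product form). [cite: BenfattoGiulianiMastropietro2006, §2.4 (2.36)] -/
theorem hasDerivAt_ppTrueKernelDu_u {β Λ : ℝ} (hβ : 0 < β) (hΛ : 0 < Λ) {B₁ B₂ : ℝ} (hB₁ : ∀ x, |deriv salmhoferCutoff x| ≤ B₁)
    (hB₂ : ∀ x, |deriv (deriv salmhoferCutoff) x| ≤ B₂) (e u : ℝ) :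
    HasDerivAt (fun v => ppTrueKernelDu β Λ e v) (ppTrueKernelDuu β Λ e u) u := by
  have hω : ∀ n : ℕ, 0 < ppFreq β n := ppFreq_pos hβ
  unfold ppTrueKernelDu ppTrueKernelDuu
  refine HasDerivAt.const_mul (2 / β) ?_
  refine hasDerivAt_tsum (u := fun n : ℕ => ((16 * B₂ + 8 * B₁) / Λ ^ 2 + 12 * B₁ * (β / π) / Λ + 15 / 2 * (β / π) ^ 2) * (1 / (ppFreq β n ^ 2 + 0 ^ 2)))
    (g := fun (n : ℕ) (v : ℝ) => uvWeightFn Λ (ppFreq β n) e *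
      ((uvWeightFnD1 Λ (ppFreq β n) v * (e * v + ppFreq β n ^ 2) + uvWeightFn Λ (ppFreq β n) v * e) / ((ppFreq β n ^ 2 + e ^ 2) * (ppFreq β n ^ 2 + v ^ 2)) -
        uvWeightFn Λ (ppFreq β n) v * (e * v + ppFreq β n ^ 2) * (2 * v) / ((ppFreq β n ^ 2 + e ^ 2) * (ppFreq β n ^ 2 + v ^ 2) ^ 2)))
    (g' := fun (n : ℕ) (v : ℝ) => uvWeightFn Λ (ppFreq β n) e *
      (uvWeightFnD2 Λ (ppFreq β n) v * ((e * v + ppFreq β n ^ 2) / ((ppFreq β n ^ 2 + e ^ 2) * (ppFreq β n ^ 2 + v ^ 2))) +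
        2 * uvWeightFnD1 Λ (ppFreq β n) v * ((e * (ppFreq β n ^ 2 - v ^ 2) - 2 * v * ppFreq β n ^ 2) / ((ppFreq β n ^ 2 + e ^ 2) * (ppFreq β n ^ 2 + v ^ 2) ^ 2)) +
        uvWeightFn Λ (ppFreq β n) v *
          ((2 * v * (v ^ 2 - 3 * ppFreq β n ^ 2) * e + (6 * v ^ 2 - 2 * ppFreq β n ^ 2) * ppFreq β n ^ 2) / ((ppFreq β n ^ 2 + e ^ 2) * (ppFreq β n ^ 2 + v ^ 2) ^ 3))))
    ((summable_one_div_ppFreq_sq_add_sq hβ 0).mul_left _) (fun n v => ?_) (fun n v => ?_) (y₀ := u) ?_ u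
  · -- termwise derivative via the structured form `W_e(W′c + Wc′)`
    have hωn := (hω n).ne'
    have hW : HasDerivAt (fun y => uvWeightFn Λ (ppFreq β n) y) (uvWeightFnD1 Λ (ppFreq β n) v) v := hasDerivAt_uvWeightFn Λ (ppFreq β n) v
    have hW1 : HasDerivAt (fun y => uvWeightFnD1 Λ (ppFreq β n) y) (uvWeightFnD2 Λ (ppFreq β n) v) v := hasDerivAt_uvWeightFnD1 Λ (ppFreq β n) v
    have hc := hasDerivAt_pairCore hωn e v
    have hc' := hasDerivAt_pairCoreD1 hωn e v
    have h := ((hW1.fun_mul hc).fun_add (hW.fun_mul hc')).const_mul (uvWeightFn Λ (ppFreq β n) e)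
    have hev : (fun y => uvWeightFn Λ (ppFreq β n) e *
        ((uvWeightFnD1 Λ (ppFreq β n) y * (e * y + ppFreq β n ^ 2) + uvWeightFn Λ (ppFreq β n) y * e) / ((ppFreq β n ^ 2 + e ^ 2) * (ppFreq β n ^ 2 + y ^ 2)) -
          uvWeightFn Λ (ppFreq β n) y * (e * y + ppFreq β n ^ 2) * (2 * y) / ((ppFreq β n ^ 2 + e ^ 2) * (ppFreq β n ^ 2 + y ^ 2) ^ 2))) =
        fun y => uvWeightFn Λ (ppFreq β n) e * (uvWeightFnD1 Λ (ppFreq β n) y * ((e * y + ppFreq β n ^ 2) / ((ppFreq β n ^ 2 + e ^ 2) * (ppFreq β n ^ 2 + y ^ 2))) +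
          uvWeightFn Λ (ppFreq β n) y * ((e * (ppFreq β n ^ 2 - y ^ 2) - 2 * y * ppFreq β n ^ 2) / ((ppFreq β n ^ 2 + e ^ 2) * (ppFreq β n ^ 2 + y ^ 2) ^ 2))) :=
      funext fun y => ppTrueKernelDu_summand_eq hωn Λ e y
    rw [hev]
    refine h.congr_deriv ?_
    ring
  · rw [Real.norm_eq_abs]; exact abs_ppTrueKernelDuu_summand_le hβ hΛ hB₁ hB₂ e v n
  · exact Summable.of_norm_bounded ((summable_one_div_ppFreq_sq_add_sq hβ 0).mul_left _) fun n => by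
      rw [Real.norm_eq_abs]; exact abs_ppTrueKernelDu_summand_le hβ hΛ hB₁ e u n

/-- **`x ↦ ∂ᵤ²P(f x, g x)` is continuous for continuous `f, g`** (joint continuity, composable form; dominator `abs_ppTrueKernelDuu_summand_le`).
[cite: BenfattoGiulianiMastropietro2006, §2.4 (2.36)] -/
theorem continuous_ppTrueKernelDuu_comp {β Λ : ℝ} (hβ : 0 < β) (hΛ : 0 < Λ) {B₁ B₂ : ℝ} (hB₁ : ∀ x, |deriv salmhoferCutoff x| ≤ B₁)
    (hB₂ : ∀ x, |deriv (deriv salmhoferCutoff) x| ≤ B₂) {X : Type*} [TopologicalSpace X] {f g : X → ℝ} (hf : Continuous f) (hg : Continuous g) :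
    Continuous fun x : X => ppTrueKernelDuu β Λ (f x) (g x) := by
  unfold ppTrueKernelDuu
  refine continuous_const.mul ?_
  refine continuous_tsum (fun n => ?_) ((summable_one_div_ppFreq_sq_add_sq hβ 0).mul_left
    ((16 * B₂ + 8 * B₁) / Λ ^ 2 + 12 * B₁ * (β / π) / Λ + 15 / 2 * (β / π) ^ 2)) fun n x => ?_
  · have hWe : Continuous fun x : X => uvWeightFn Λ (ppFreq β n) (f x) := (continuous_uvWeightFn_level Λ _).comp hf
    have hWu : Continuous fun x : X => uvWeightFn Λ (ppFreq β n) (g x) := (continuous_uvWeightFn_level Λ _).comp hg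
    have hW1u : Continuous fun x : X => uvWeightFnD1 Λ (ppFreq β n) (g x) := (continuous_uvWeightFnD1_level Λ _).comp hg
    have hW2u : Continuous fun x : X => uvWeightFnD2 Λ (ppFreq β n) (g x) := (continuous_uvWeightFnD2_level Λ _).comp hg
    have hω := ppFreq_pos hβ n
    have hne1 : ∀ x : X, (ppFreq β n ^ 2 + f x ^ 2) * (ppFreq β n ^ 2 + g x ^ 2) ≠ 0 := fun x => by positivity
    have hne2 : ∀ x : X, (ppFreq β n ^ 2 + f x ^ 2) * (ppFreq β n ^ 2 + g x ^ 2) ^ 2 ≠ 0 := fun x => by positivity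
    have hne3 : ∀ x : X, (ppFreq β n ^ 2 + f x ^ 2) * (ppFreq β n ^ 2 + g x ^ 2) ^ 3 ≠ 0 := fun x => by positivity
    have hA : Continuous fun x : X => (f x * g x + ppFreq β n ^ 2) / ((ppFreq β n ^ 2 + f x ^ 2) * (ppFreq β n ^ 2 + g x ^ 2)) :=
      Continuous.div (by fun_prop) (by fun_prop) hne1
    have hB : Continuous fun x : X => (f x * (ppFreq β n ^ 2 - g x ^ 2) - 2 * g x * ppFreq β n ^ 2) / ((ppFreq β n ^ 2 + f x ^ 2) * (ppFreq β n ^ 2 + g x ^ 2) ^ 2) :=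
      Continuous.div (by fun_prop) (by fun_prop) hne2
    have hC : Continuous fun x : X => (2 * g x * (g x ^ 2 - 3 * ppFreq β n ^ 2) * f x + (6 * g x ^ 2 - 2 * ppFreq β n ^ 2) * ppFreq β n ^ 2) /
        ((ppFreq β n ^ 2 + f x ^ 2) * (ppFreq β n ^ 2 + g x ^ 2) ^ 3) :=
      Continuous.div (by fun_prop) (by fun_prop) hne3
    exact hWe.mul (((hW2u.mul hA).add ((continuous_const.mul hW1u).mul hB)).add (hWu.mul hC))
  · rw [Real.norm_eq_abs]; exact abs_ppTrueKernelDuu_summand_le hβ hΛ hB₁ hB₂ (f x) (g x) n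

/-- `u ↦ ∂ᵤ²P(e,u)` is continuous. [cite: BenfattoGiulianiMastropietro2006, §2.4 (2.36)] -/
theorem continuous_ppTrueKernelDuu_u {β Λ : ℝ} (hβ : 0 < β) (hΛ : 0 < Λ) {B₁ B₂ : ℝ} (hB₁ : ∀ x, |deriv salmhoferCutoff x| ≤ B₁)
    (hB₂ : ∀ x, |deriv (deriv salmhoferCutoff) x| ≤ B₂) (e : ℝ) : Continuous fun u : ℝ => ppTrueKernelDuu β Λ e u :=
  continuous_ppTrueKernelDuu_comp hβ hΛ hB₁ hB₂ continuous_const continuous_id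

/-- **`u ↦ P(e,u)` is `C²`** — the M-law's `hK` for the true kernel, at EVERY loop level `e`. [cite: BenfattoGiulianiMastropietro2006, §2.4 (2.36)] -/
theorem contDiff_two_ppTrueKernel_u {β Λ : ℝ} (hβ : 0 < β) (hΛ : 0 < Λ) {B₁ B₂ : ℝ} (hB₁ : ∀ x, |deriv salmhoferCutoff x| ≤ B₁)
    (hB₂ : ∀ x, |deriv (deriv salmhoferCutoff) x| ≤ B₂) (e : ℝ) : ContDiff ℝ 2 (fun u : ℝ => ppTrueKernel β Λ e u) :=
  contDiff_two_of_hasDerivAt₂ (hasDerivAt_ppTrueKernel_u hβ hΛ hB₁ e) (hasDerivAt_ppTrueKernelDu_u hβ hΛ hB₁ hB₂ e) (continuous_ppTrueKernelDuu_u hβ hΛ hB₁ hB₂ e)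

/-- `deriv P(e,·) = ∂ᵤP`. [cite: BenfattoGiulianiMastropietro2006, §2.4 (2.36)] -/
theorem deriv_ppTrueKernel_u {β Λ : ℝ} (hβ : 0 < β) (hΛ : 0 < Λ) {B₁ : ℝ} (hB₁ : ∀ x, |deriv salmhoferCutoff x| ≤ B₁) (e : ℝ) :
    deriv (fun u : ℝ => ppTrueKernel β Λ e u) = fun u => ppTrueKernelDu β Λ e u :=
  funext fun u => (hasDerivAt_ppTrueKernel_u hβ hΛ hB₁ e u).deriv

/-- `iteratedDeriv 2 P(e,·) = ∂ᵤ²P`. [cite: BenfattoGiulianiMastropietro2006, §2.4 (2.36)] -/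
theorem iteratedDeriv_two_ppTrueKernel_u {β Λ : ℝ} (hβ : 0 < β) (hΛ : 0 < Λ) {B₁ B₂ : ℝ} (hB₁ : ∀ x, |deriv salmhoferCutoff x| ≤ B₁)
    (hB₂ : ∀ x, |deriv (deriv salmhoferCutoff) x| ≤ B₂) (e : ℝ) :
    iteratedDeriv 2 (fun u : ℝ => ppTrueKernel β Λ e u) = fun u => ppTrueKernelDuu β Λ e u := by
  rw [iteratedDeriv_succ, iteratedDeriv_one, deriv_ppTrueKernel_u hβ hΛ hB₁ e]
  exact funext fun u => (hasDerivAt_ppTrueKernelDu_u hβ hΛ hB₁ hB₂ e u).deriv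

/-! ## §3 Agreement with the signed formula off the anti-diagonal -/

/-- Off the anti-diagonal `∂ᵤ²P = ∂ᵤ²N/(e+u) − 2∂ᵤN/(e+u)² + 2N/(e+u)³`. [cite: BenfattoGiulianiMastropietro2006, §2.4 (2.36)] -/
theorem ppTrueKernelDuu_eq_of_ne {β Λ : ℝ} (hβ : 0 < β) (hΛ : 0 < Λ) {B₁ B₂ : ℝ} (hB₁ : ∀ x, |deriv salmhoferCutoff x| ≤ B₁)
    (hB₂ : ∀ x, |deriv (deriv salmhoferCutoff) x| ≤ B₂) {e u : ℝ} (hs : e + u ≠ 0) :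
    ppTrueKernelDuu β Λ e u =
      ppTrueNumeratorDuu β Λ e u / (e + u) - 2 * ppTrueNumeratorDu β Λ e u / (e + u) ^ 2 + 2 * ppTrueNumerator β Λ e u / (e + u) ^ 3 := by
  have h1 := hasDerivAt_ppTrueKernelDu_u hβ hΛ hB₁ hB₂ e u
  have h2 := hasDerivAt_trueKernelDu_signed hβ hΛ hB₁ hB₂ hs
  have hev : (fun v : ℝ => ppTrueKernelDu β Λ e v) =ᶠ[𝓝 u] fun v => ppTrueNumeratorDu β Λ e v / (e + v) - ppTrueNumerator β Λ e v / (e + v) ^ 2 := by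
    have ho : IsOpen {v : ℝ | e + v ≠ 0} := isOpen_ne_fun (continuous_const.add continuous_id) continuous_const
    filter_upwards [ho.mem_nhds hs] with v hv
    exact ppTrueKernelDu_eq_of_ne hβ hΛ hB₁ hv
  exact h1.unique (h2.congr_of_eventuallyEq hev)

/-! ## §4 The envelopes at every partner level -/

/-- Continuity-extension tool: a continuous `F` bounded by a continuous-at-`u` majorant `G` on a punctured neighbourhood is bounded at `u`. [folklore] -/
theorem le_of_abs_le_nhdsWithin_ne {F G : ℝ → ℝ} {u : ℝ} (hF : Continuous F) (hG : ContinuousAt G u) (h : ∀ᶠ v in 𝓝[≠] u, |F v| ≤ G v) : |F u| ≤ G u :=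
  le_of_tendsto_of_tendsto (hF.abs.continuousAt.tendsto.mono_left nhdsWithin_le_nhds) (hG.tendsto.mono_left nhdsWithin_le_nhds) h

/-- `v ↦ C·(max e |v|)⁻¹^k` is continuous at any `u` when `0 < e`. [folklore] -/
theorem continuousAt_const_mul_inv_max_pow {e : ℝ} (he : 0 < e) (C : ℝ) (k : ℕ) (u : ℝ) : ContinuousAt (fun v : ℝ => C * (max e |v|)⁻¹ ^ k) u :=
  continuousAt_const.mul (((continuous_const.max continuous_abs).continuousAt.inv₀ (by have := le_max_left e |u|; positivity)).pow k)

/-- **`hK2` for the product form on a support condition**: `0 < e`, `0 < c ≤ 1`, `c·e ≤ |u|` ⟹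
`|∂ᵤ²P(e,u)| ≤ (256B₃+768B₂+2496B₁+1528+(32B₂+48B₁+66)/c²+(48B₁+36)/c)·(max e |u|)⁻¹³` for EVERY such `u` (the point `u = −e` by continuity from the left).
[cite: BenfattoGiulianiMastropietro2006, §2.4 (2.36)] -/
theorem abs_ppTrueKernelDuu_le_inv_max_cube {β Λ : ℝ} (hβ : 0 < β) (hΛ : 0 < Λ) {B₁ B₂ B₃ : ℝ} (hB₁ : ∀ x, |deriv salmhoferCutoff x| ≤ B₁)
    (hB₂ : ∀ x, |deriv (deriv salmhoferCutoff) x| ≤ B₂) (hB₃ : ∀ x, |deriv (deriv (deriv salmhoferCutoff)) x| ≤ B₃) {c e u : ℝ} (hc : 0 < c) (hc1 : c ≤ 1)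
    (he : 0 < e) (hsupp : c * e ≤ |u|) :
    |ppTrueKernelDuu β Λ e u| ≤ (256 * B₃ + 768 * B₂ + 2496 * B₁ + 1528 + (32 * B₂ + 48 * B₁ + 66) / c ^ 2 + (48 * B₁ + 36) / c) * (max e |u|)⁻¹ ^ 3 := by
  set C : ℝ := 256 * B₃ + 768 * B₂ + 2496 * B₁ + 1528 + (32 * B₂ + 48 * B₁ + 66) / c ^ 2 + (48 * B₁ + 36) / c with hC
  have hoff : ∀ v : ℝ, e + v ≠ 0 → c * e ≤ |v| → |ppTrueKernelDuu β Λ e v| ≤ C * (max e |v|)⁻¹ ^ 3 := fun v hv hsv => by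
    rw [ppTrueKernelDuu_eq_of_ne hβ hΛ hB₁ hB₂ hv]; exact abs_trueKernelDuu_signed_le_inv_max_cube hβ hΛ hB₁ hB₂ hB₃ hc hc1 he hv hsv
  rcases ne_or_eq (e + u) 0 with hs | hs
  · exact hoff u hs hsupp
  · have hu : u = -e := by linarith
    have hev : ∀ᶠ v in 𝓝[<] u, |ppTrueKernelDuu β Λ e v| ≤ C * (max e |v|)⁻¹ ^ 3 := by
      filter_upwards [self_mem_nhdsWithin] with v hv
      have hv' : v < -e := by rw [hu] at hv; exact hv
      refine hoff v (by linarith) ?_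
      rw [abs_of_neg (by linarith)]; nlinarith
    exact le_of_tendsto_of_tendsto ((continuous_ppTrueKernelDuu_u hβ hΛ hB₁ hB₂ e).abs.continuousAt.tendsto.mono_left nhdsWithin_le_nhds)
      ((continuousAt_const_mul_inv_max_pow he C 3 u).tendsto.mono_left nhdsWithin_le_nhds) hev

/-- **`hK1` for the product form at a near-shell loop level, ALL partner levels**: `0 < e ≤ K·Λ`, `1 ≤ K` ⟹
`|∂ᵤP(e,u)| ≤ (64B₂+120B₁+158+(12B₁+5)K)·(max e |u|)⁻¹²` for every `u ∈ ℝ`. [cite: BenfattoGiulianiMastropietro2006, §2.4 (2.36)] -/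
theorem abs_ppTrueKernelDu_le_inv_max_sq_of_le_mul {β Λ : ℝ} (hβ : 0 < β) (hΛ : 0 < Λ) {B₁ B₂ : ℝ} (hB₁ : ∀ x, |deriv salmhoferCutoff x| ≤ B₁)
    (hB₂ : ∀ x, |deriv (deriv salmhoferCutoff) x| ≤ B₂) {K e : ℝ} (hK : 1 ≤ K) (he : 0 < e) (heK : e ≤ K * Λ) (u : ℝ) :
    |ppTrueKernelDu β Λ e u| ≤ (64 * B₂ + 120 * B₁ + 158 + (12 * B₁ + 5) * K) * (max e |u|)⁻¹ ^ 2 := by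
  set C : ℝ := 64 * B₂ + 120 * B₁ + 158 + (12 * B₁ + 5) * K with hC
  have hoff : ∀ v : ℝ, e + v ≠ 0 → |ppTrueKernelDu β Λ e v| ≤ C * (max e |v|)⁻¹ ^ 2 := fun v hv => by
    rw [ppTrueKernelDu_eq_of_ne hβ hΛ hB₁ hv]; exact abs_trueKernelDu_signed_le_of_le_mul hβ hΛ hB₁ hB₂ hK he heK hv
  rcases ne_or_eq (e + u) 0 with hs | hs
  · exact hoff u hs
  · have hu : u = -e := by linarith
    refine le_of_abs_le_nhdsWithin_ne (continuous_ppTrueKernelDu_u hβ hΛ hB₁ e) (continuousAt_const_mul_inv_max_pow he C 2 u) ?_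
    filter_upwards [self_mem_nhdsWithin] with v hv
    have hvu : v ≠ u := hv
    exact hoff v (by intro h0; exact hvu (by rw [hu]; linarith))

/-- **`hK2` for the product form at a near-shell loop level, ALL partner levels**: `0 < e ≤ K·Λ`, `1 ≤ K` ⟹
`|∂ᵤ²P(e,u)| ≤ (256B₃+768B₂+2496B₁+1512+(128B₂+288B₁+368)+(32B₂+48B₁+60)K²+(48B₁+20)K)·(max e |u|)⁻¹³` for every `u ∈ ℝ`.
[cite: BenfattoGiulianiMastropietro2006, §2.4 (2.36)] -/
theorem abs_ppTrueKernelDuu_le_inv_max_cube_of_le_mul {β Λ : ℝ} (hβ : 0 < β) (hΛ : 0 < Λ) {B₁ B₂ B₃ : ℝ} (hB₁ : ∀ x, |deriv salmhoferCutoff x| ≤ B₁)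
    (hB₂ : ∀ x, |deriv (deriv salmhoferCutoff) x| ≤ B₂) (hB₃ : ∀ x, |deriv (deriv (deriv salmhoferCutoff)) x| ≤ B₃) {K e : ℝ} (hK : 1 ≤ K) (he : 0 < e)
    (heK : e ≤ K * Λ) (u : ℝ) :
    |ppTrueKernelDuu β Λ e u| ≤
      (256 * B₃ + 768 * B₂ + 2496 * B₁ + 1512 + (128 * B₂ + 288 * B₁ + 368) + (32 * B₂ + 48 * B₁ + 60) * K ^ 2 + (48 * B₁ + 20) * K) * (max e |u|)⁻¹ ^ 3 := by
  set C : ℝ := 256 * B₃ + 768 * B₂ + 2496 * B₁ + 1512 + (128 * B₂ + 288 * B₁ + 368) + (32 * B₂ + 48 * B₁ + 60) * K ^ 2 + (48 * B₁ + 20) * K with hC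
  have hoff : ∀ v : ℝ, e + v ≠ 0 → |ppTrueKernelDuu β Λ e v| ≤ C * (max e |v|)⁻¹ ^ 3 := fun v hv => by
    rw [ppTrueKernelDuu_eq_of_ne hβ hΛ hB₁ hB₂ hv]; exact abs_trueKernelDuu_signed_le_of_le_mul hβ hΛ hB₁ hB₂ hB₃ hK he heK hv
  rcases ne_or_eq (e + u) 0 with hs | hs
  · exact hoff u hs
  · have hu : u = -e := by linarith
    refine le_of_abs_le_nhdsWithin_ne (continuous_ppTrueKernelDuu_u hβ hΛ hB₁ hB₂ e) (continuousAt_const_mul_inv_max_pow he C 3 u) ?_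
    filter_upwards [self_mem_nhdsWithin] with v hv
    have hvu : v ≠ u := hv
    exact hoff v (by intro h0; exact hvu (by rw [hu]; linarith))

end Summit.HubbardSuperconductivity.HubbardSuperconductivity.Theorems.C4a

end
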